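import Summits.CriticalPhenomena.SAWScalingLimit.Theses.SAWConePseudogroup
import Summits.CriticalPhenomena.SAWScalingLimit.Theses.SAWConfRestriction
import Summits.CriticalPhenomena.SAWScalingLimit.Theses.SAWBrownianDomination
import Summits.CriticalPhenomena.SAWScalingLimit.Theses.SAWTowerCount
import Summits.CriticalPhenomena.SAWScalingLimit.Theses.SAWTensorRG
import Summits.CriticalPhenomena.SAWScalingLimit.Theses.SAWExpCovariance
import Literature.Probability.RandomPlanarGeometry.SAWScalingLimitFamily
import Literature.Probability.RandomPlanarGeometry.ConformalRestrictionProofs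
import Summits.CriticalPhenomena.SAWScalingLimit.Theorems.SAWTensorRGRestrictionOfLimitStubLatticeRestriction
import Summits.CriticalPhenomena.SAWScalingLimit.Theorems.SAWTensorRGRestrictionOfLimitStubDomination
import Summits.CriticalPhenomena.SAWScalingLimit.Theorems.SAWTensorRGRestrictionOfLimitStubInteriorAvoidance
import Summits.CriticalPhenomena.SAWScalingLimit.Theorems.SAWTensorRGRestrictionOfLimitGenericRestriction
import Summits.CriticalPhenomena.SAWScalingLimit.Theorems.SAWTensorRGRestrictionOfLimitStubRestrictionOfSqueeze
import Summits.CriticalPhenomena.SAWScalingLimit.Theorems.SAWTensorRGRestrictionOfLimitStubSqueezeFamily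
import Summits.CriticalPhenomena.SAWScalingLimit.Theorems.SAWTensorRGRestrictionOfLimitStubRadoSqueezeFamily
import Literature.Probability.RandomPlanarGeometry.CovariantSqueezeContinuity
import Summits.CriticalPhenomena.SAWScalingLimit.Theorems.SAWTensorRGRestrictionOfLimitOfConfCov
import Summits.CriticalPhenomena.SAWScalingLimit.Theorems.SAWTensorRGRestrictionOfLimitOfContinuityOfLimit

/-!
# Line `birth` — registered skeleton for the crux `RestrictionOfLimit` (stmt-CriticalPhenomena-0773)

**RESHAPE (lead c2, prover-line-stmt-CriticalPhenomena-0773-c2-0, 2026-08-17).** Two further compositions are registered,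
the ones the five consuming routes can actually use: composition 4 — the EXISTING crux `ConfCovLimit` (stmt-CriticalPhenomena-0771,
registered by name as `stub_confCovLimit`) implies the crux, through the bridge `stub_restrictionOfLimitOfConfCovLimit`
(`ConfCovLimit → RestrictionOfLimit`, LANDED p172190 as `Theorems/SAWTensorRGRestrictionOfLimitOfConfCov.lean` together with the five
deciding theorems `closes` re-proved WITHOUT this item: a conformally covariant scaling limit is weakly continuous along Radó squeezes —
`IsConformallyCovariant.tendsto_integral_of_discUniformizers`, Literature/CovariantSqueezeContinuity — then G + F′; uniqueness
of the scaling limit transfers covariance across the binder); composition 5 — the EXISTING crux `ContinuityOfLimit`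
(stmt-CriticalPhenomena-7305, Radó continuity of the limit BEFORE conformal invariance) implies the crux, through the bridge
`stub_restrictionOfLimitOfContinuityOfLimit` (LANDED p172244 as `Theorems/SAWTensorRGRestrictionOfLimitOfContinuityOfLimit.lean`, with
`ContinuityOfLimit → DiscContinuity` and `ConfCovLimit → ContinuityOfLimit`; Carathéodory: closed-disc uniformizers of Jordan domains are injective on the
closed disc, so a Radó squeeze is an instance of `IsRadoContinuous`; sequentialisation along `𝓝[>] 0`). In every deciding
theorem `closes` of the five routes the covariance (or Radó continuity) of `P` is in scope where this item is invoked, so the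
item is redundant for the routes; as TYPED it stays equivalent to outer domain continuity of the abstract limit (compositions 2/3).

**RESULT (lead c1, 2026-08-17, end of the continuation).** The crux is FORMALLY REDUCED to the existing crux
`DiscContinuity` (stmt-CriticalPhenomena-6755, route SAWExpCovariance): composition 3 below has the single hypothesis
`stub_discContinuity := SAWExpCovariance.DiscContinuity`, everything else being LANDED — G `stub_restrictionOfSqueeze`
(p154640), F `stub_squeezeFamily` (p159317 + 5 helper files), F′ `stub_radoSqueezeFamily` (p167791 + 13 helper files);
the sorry-free conditional theorem `DiscContinuity → RestrictionOfLimit` (all five route copies) is in the tree as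
`Theorems/SAWTensorRGRestrictionOfLimitOfDiscContinuity.lean` (p168098), and the hull-narrowed dependency (outer Radó
continuity AWAY from the marked points ⇒ `IsHullRestriction`) as
`Theorems/SAWTensorRGRestrictionOfLimitHullRestrictionOfOuterContinuity.lean` (p168317). Outcome: blocked-on stmt-6755.

**Status (lead c1, prover-line-stmt-CriticalPhenomena-0773-c1-0, 2026-08-17, cycle 1 of the continuation).**
LANDED before this cycle (all `--supports stmt-CriticalPhenomena-0773`, namespace
`Summit.CriticalPhenomena.SAWScalingLimit.Theorems.RestrictionOfLimit.Birth`): S1 `stub_latticeRestriction`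
(p147518), S2 `stub_domination` (p148885), S3b `stub_interiorAvoidance` (p150671), generic restriction
`stub_restrictionOffCountable` (p151626, with the localised squeezes `restriction_pair_of_noAvoidanceLoss /
restriction_pair_of_nullTouch`). They are discharged inside the compositions below.

RESHAPE (this cycle). Two things changed, both forced by the analysis in `NOTES.md ## Census`:

1. The non-hull stub is now the `∃`-APPROXIMATION form `stub_noAvoidanceLossNonHullExists` ("for SOME endpoint
   approximation of `D'` there is no loss of avoidance mass"), which is exactly what the composition consumes
   (`restriction_pair_of_noAvoidanceLoss` needs one approximation). The registered `∀`-form was MIS-CUT: for a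
   non-hull pair the removed part `D ∖ D'` may contain sub-lattice dents ON lattice edges adjacent to a given
   `a_δ` along `δ = 2^{-k}` — invisible to the limit event `{γ ⊆ cl D'}` but each killing a fixed fraction of the
   lattice avoidance mass (finite energy at the tip) — so "no loss for EVERY approximation" is false in reality
   while unrefutable in the tree (it needs the SAW limit to exist). The hull stub S3a `stub_nullTouchHull` is
   unchanged (approximation-free).
2. A SECOND composition is registered: `RestrictionOfLimit_of_squeeze`. Generic restriction (landed) says the
   identity can fail only on countably many members of any SEPARATED family of intermediate domains; hence, for a
   pair `D' ⊆ D`, if `D'` is squeezed from outside by a separated family `E_t ↓ D'` (`t ↓ 0`) of sub-domains of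
   `D` with the same marked points ALONG WHICH `P (E_t) ⇒ P (D')` weakly, then `P D' = P D (· | γ ⊆ cl D')`:
   off the exceptional set `P (E_t) = P D (· | γ ⊆ cl E_t)`, which tends setwise to `P D (· | γ ⊆ cl D')` by
   continuity from above, and weak limits are unique. This isolates the crux's content, for ALL pairs (hull or
   not), as OUTER CONTINUITY OF THE SCALING LIMIT IN THE DOMAIN (`stub_squeezeContinuity`, the analytic debt —
   a special case of the route's own `ContinuityOfLimit`, stmt-7305, before conformal invariance) plus the
   existence of squeezing families (`stub_squeezeFamily`, plane topology of Jordan sub-domains, no probability)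
   plus a glue that is provable now (`stub_restrictionOfSqueeze`).

Crux (FIXED; shared verbatim by the routes SAWConePseudogroup r7, SAWConfRestriction r4, SAWBrownianDomination
r5, SAWTensorRG r5, SAWTowerCount support): every chordal family `P` that is the FULL scaling limit `(lim)` of
the critical `δℤ²` SAW laws (every Dobrushin domain, EVERY endpoint approximation) has the two-sided restriction
property in product form, `∀ D' ⊆ D (Dobrushin, same marked points), ∀ T Borel,
P D' (T) · P D {γ ⊆ cl D'} = P D (T ∩ {γ ⊆ cl D'})`. The hypothesis is literally `SAW.IsScalingLimitFamily P`,
under which `P` is unique: the crux is a statement about THE scaling limit of the SAW.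
Source: Lawler–Schramm–Werner, *On the scaling limit of planar self-avoiding walk* (arXiv:math/0204277), p. 14
§3.4.5 ("By definition, the measures `μ_saw(z,w;D,N)` satisfy the restriction property … (in the appropriate
sense). Hence, the limit measure, assuming it exists, must satisfy this property.").

## Composition 1 (`RestrictionOfLimit_of`): lattice identity → domination → no loss of avoidance mass

With `S_δ` = the walks of `D_δ` that are walks of `D'_δ`, `p_δ = P_{D,δ}(S_δ) = Z_{D'_δ}/Z_{D_δ}`,
`c = liminf_{δ→0⁺} p_δ`, `μ = P D`, `ν = P D'`, `R = {γ ⊆ cl D'}`, `F = closure (D ∖ D')`: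
S1 (landed) `P_{D',δ}(curve ∈ T) · p_δ = P_{D,δ}({curve ∈ T} ∩ S_δ)`; S2 (landed) `c · ν(T) ≤ μ(T ∩ R)`;
S3b (landed) `μ {range ∩ F = ∅} ≤ c`; S3a (OPEN, hull pairs) `μ (R ∩ {range ∩ F ≠ ∅}) = 0`; S3c∃ (OPEN, non-hull
pairs) `∃` approximation with `μ(R) ≤ c`. Then `μ(R) ≤ c` for some approximation in every case, and the
localised squeeze `restriction_pair_of_noAvoidanceLoss` (landed) gives the identity.

## Composition 2 (`RestrictionOfLimit_of_squeeze`): generic restriction + outer squeeze continuity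

If `μ(R) = 0` both sides vanish. Otherwise `stub_squeezeFamily` gives a separated exhausting family
`E : ℝ → DobrushinDomain` (`D' ⊆ E t ⊆ D`, same marks, `cl (E s) ∩ cl (D ∖ E t) = ∅` for `0 < s < t`,
`⋂_{t>0} {γ ⊆ cl (E t)} ⊆ {γ ⊆ cl D'}`), `stub_squeezeContinuity` gives `P (E t) ⇒ P D'` as `t → 0⁺`, and the glue
`stub_restrictionOfSqueeze` (provable: generic restriction off a countable set of `t`, a sequence `t_n ↓ 0` off it,
continuity from above, portmanteau, uniqueness of weak limits via closed sets) gives the identity.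

Inputs PROVED in the tree, to be used, not re-stubbed: everything in the four landed files above,
`SAW.exists_isEndpointApprox`, `SAW.IsScalingLimitFamily.isProbabilityMeasure / tendstoLaw / unique`,
`CurveClass.isClosed_rangeSubset / measurableSet_rangeSubset`, Mathlib portmanteau
(`ProbabilityMeasure.limsup_measure_closed_le_of_tendsto` & co., wrapped along a filter as
`limsup_measure_closed_le_of_forall_integral_tendsto / le_liminf_measure_open_of_forall_integral_tendsto`),
`MeasureTheory.ext_of_generate_finite` / `borel_eq_generateFrom_isClosed`.
Disproof used: none — no `Disproof.lean` / `_false_without_` theorem exists for this crux (ledger crux ls,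
2026-08-17T09:52Z). Negatives index: none is a passage-to-the-limit statement.
-/

noncomputable section

open MeasureTheory Filter Topology Set
open scoped ENNReal BoundedContinuousFunction
open Literature.Probability.RandomPlanarGeometry Literature.Probability.LatticeModels

namespace Summit.CriticalPhenomena.SAWScalingLimit.Cruxes.RestrictionOfLimit.Birth

/-! ### Vocabulary of the line: the named statements -/

/-- **S1, named** (LANDED). The exact lattice restriction identity at fixed mesh. -/
def LatticeRestriction : Prop :=
  ∀ (Ω Ω' : Set ℂ) (δ : ℝ) (a b : Site 2),
    discreteDomainGraph Ω' δ ≤ discreteDomainGraph Ω δ →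
      ∀ T : Set (CurveClass ℂ),
        SAW.law Ω' δ a b ((fun γ : SAW.DomainSAW Ω' δ a b => γ.curve) ⁻¹' T) *
            SAW.law Ω δ a b
              {γ : SAW.DomainSAW Ω δ a b | ∀ e ∈ γ.walk.edges, e ∈ (discreteDomainGraph Ω' δ).edgeSet} =
          SAW.law Ω δ a b
            (((fun γ : SAW.DomainSAW Ω δ a b => γ.curve) ⁻¹' T) ∩
              {γ : SAW.DomainSAW Ω δ a b | ∀ e ∈ γ.walk.edges, e ∈ (discreteDomainGraph Ω' δ).edgeSet})

/-- **S2, named** (LANDED). Domination: `c · P D'(T) ≤ P D (T ∩ {γ ⊆ cl D'})`. -/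
def Domination : Prop :=
  LatticeRestriction →
    ∀ P : ChordalFamily, SAW.IsScalingLimitFamily P →
      ∀ (D D' : DobrushinDomain), D'.carrier ⊆ D.carrier → D'.pt 0 = D.pt 0 → D'.pt 1 = D.pt 1 →
        ∀ (a b : ℝ → Site 2), SAW.IsEndpointApprox D' a b →
          ∀ T : Set (CurveClass ℂ), MeasurableSet T →
            Filter.liminf (fun δ : ℝ => SAW.law D.carrier δ (a δ) (b δ)
                {γ : SAW.DomainSAW D.carrier δ (a δ) (b δ) |
                  ∀ e ∈ γ.walk.edges, e ∈ (discreteDomainGraph D'.carrier δ).edgeSet})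
              (𝓝[>] (0 : ℝ)) * P D' T ≤
            P D (T ∩ CurveClass.rangeSubset (closure D'.carrier))

/-- **S3∃, named.** NO LOSS OF AVOIDANCE MASS FOR SOME ENDPOINT APPROXIMATION: for every pair `D' ⊆ D` with the
same marked points there is an endpoint approximation of `D'` along which
`P D {γ ⊆ cl D'} ≤ liminf_{δ→0⁺} P_{D,δ}[the walk is a walk of D'_δ]` — the form the squeeze consumes. -/
def ExistsNoAvoidanceLoss : Prop :=
  ∀ P : ChordalFamily, SAW.IsScalingLimitFamily P →
    ∀ (D D' : DobrushinDomain), D'.carrier ⊆ D.carrier → D'.pt 0 = D.pt 0 → D'.pt 1 = D.pt 1 →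
      ∃ a b : ℝ → Site 2, SAW.IsEndpointApprox D' a b ∧
        P D (CurveClass.rangeSubset (closure D'.carrier)) ≤
          Filter.liminf (fun δ : ℝ => SAW.law D.carrier δ (a δ) (b δ)
              {γ : SAW.DomainSAW D.carrier δ (a δ) (b δ) |
                ∀ e ∈ γ.walk.edges, e ∈ (discreteDomainGraph D'.carrier δ).edgeSet})
            (𝓝[>] (0 : ℝ))

/-- **S3b, named** (LANDED). Interior avoidance passes: `P D {range ∩ closure (D ∖ D') = ∅} ≤ liminf p_δ`. -/
def InteriorAvoidance : Prop :=
  ∀ P : ChordalFamily, SAW.IsScalingLimitFamily P →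
    ∀ (D D' : DobrushinDomain), D'.carrier ⊆ D.carrier → D'.pt 0 = D.pt 0 → D'.pt 1 = D.pt 1 →
      ∀ (a b : ℝ → Site 2), SAW.IsEndpointApprox D' a b →
        P D (CurveClass.rangeSubset (closure (D.carrier \ D'.carrier))ᶜ) ≤
          Filter.liminf (fun δ : ℝ => SAW.law D.carrier δ (a δ) (b δ)
              {γ : SAW.DomainSAW D.carrier δ (a δ) (b δ) |
                ∀ e ∈ γ.walk.edges, e ∈ (discreteDomainGraph D'.carrier δ).edgeSet})
            (𝓝[>] (0 : ℝ))

/-- **S3a, named** (OPEN). Null touching for hull sub-domains. -/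
def NullTouchHull : Prop :=
  ∀ P : ChordalFamily, SAW.IsScalingLimitFamily P →
    ∀ (D D' : DobrushinDomain), D.IsHullSubdomain D' →
      P D (CurveClass.rangeSubset (closure D'.carrier) ∩
        {γ : CurveClass ℂ | (γ.range ∩ closure (D.carrier \ D'.carrier)).Nonempty}) = 0

/-- **S3c∃, named** (OPEN). No loss of avoidance mass for NON-hull pairs, for SOME endpoint approximation. -/
def NoAvoidanceLossNonHullExists : Prop :=
  ∀ P : ChordalFamily, SAW.IsScalingLimitFamily P →
    ∀ (D D' : DobrushinDomain), D'.carrier ⊆ D.carrier → D'.pt 0 = D.pt 0 → D'.pt 1 = D.pt 1 →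
      ¬ D.IsHullSubdomain D' →
        ∃ a b : ℝ → Site 2, SAW.IsEndpointApprox D' a b ∧
          P D (CurveClass.rangeSubset (closure D'.carrier)) ≤
            Filter.liminf (fun δ : ℝ => SAW.law D.carrier δ (a δ) (b δ)
                {γ : SAW.DomainSAW D.carrier δ (a δ) (b δ) |
                  ∀ e ∈ γ.walk.edges, e ∈ (discreteDomainGraph D'.carrier δ).edgeSet})
              (𝓝[>] (0 : ℝ))

/-- **G (glue of composition 2), named** (provable now). RESTRICTION FROM AN OUTER SQUEEZE: if `D'` is squeezed from
outside inside `D` by a separated exhausting family `E t` (`t > 0`) of Dobrushin domains with the marked points of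
`D`, along which `P (E t) ⇒ P D'` weakly as `t → 0⁺`, then the restriction identity holds for the pair `(D, D')`. -/
def RestrictionOfSqueeze : Prop :=
  ∀ P : ChordalFamily, SAW.IsScalingLimitFamily P →
    ∀ (D D' : DobrushinDomain) (E : ℝ → DobrushinDomain),
      (∀ t : ℝ, 0 < t → D'.carrier ⊆ (E t).carrier ∧ (E t).carrier ⊆ D.carrier ∧
        (E t).pt 0 = D.pt 0 ∧ (E t).pt 1 = D.pt 1) →
      (∀ s t : ℝ, 0 < s → s < t → closure (E s).carrier ∩ closure (D.carrier \ (E t).carrier) = ∅) →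
      (∀ γ : CurveClass ℂ, (∀ t : ℝ, 0 < t → γ.range ⊆ closure (E t).carrier) →
        γ.range ⊆ closure D'.carrier) →
      (∀ f : CurveClass ℂ →ᵇ ℝ, Tendsto (fun t : ℝ => ∫ γ, f γ ∂(P (E t))) (𝓝[>] (0 : ℝ))
        (𝓝 (∫ γ, f γ ∂(P D')))) →
      ∀ T : Set (CurveClass ℂ), MeasurableSet T →
        P D' T * P D (CurveClass.rangeSubset (closure D'.carrier)) =
          P D (T ∩ CurveClass.rangeSubset (closure D'.carrier))

/-- **F (geometry of composition 2), named** (OPEN, plane topology). Every pair `D' ⊆ D` of Dobrushin domains with the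
same marked points admits a separated exhausting OUTER SQUEEZE inside `D`. -/
def SqueezeFamily : Prop :=
  ∀ (D D' : DobrushinDomain), D'.carrier ⊆ D.carrier → D'.pt 0 = D.pt 0 → D'.pt 1 = D.pt 1 →
    ∃ E : ℝ → DobrushinDomain,
      (∀ t : ℝ, 0 < t → D'.carrier ⊆ (E t).carrier ∧ (E t).carrier ⊆ D.carrier ∧
        (E t).pt 0 = D.pt 0 ∧ (E t).pt 1 = D.pt 1) ∧
      (∀ s t : ℝ, 0 < s → s < t → closure (E s).carrier ∩ closure (D.carrier \ (E t).carrier) = ∅) ∧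
      (∀ γ : CurveClass ℂ, (∀ t : ℝ, 0 < t → γ.range ⊆ closure (E t).carrier) →
        γ.range ⊆ closure D'.carrier)

/-- **C (analysis of composition 2), named** (OPEN — the crux's content for all pairs). OUTER SQUEEZE CONTINUITY of a
full SAW scaling limit: along every separated exhausting outer squeeze of `D'` inside `D`, `P (E t) ⇒ P D'` weakly as
`t → 0⁺`, whenever `P D {γ ⊆ cl D'} ≠ 0`. -/
def SqueezeContinuity : Prop :=
  ∀ P : ChordalFamily, SAW.IsScalingLimitFamily P →
    ∀ (D D' : DobrushinDomain), D'.carrier ⊆ D.carrier → D'.pt 0 = D.pt 0 → D'.pt 1 = D.pt 1 →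
      ∀ E : ℝ → DobrushinDomain,
        (∀ t : ℝ, 0 < t → D'.carrier ⊆ (E t).carrier ∧ (E t).carrier ⊆ D.carrier ∧
          (E t).pt 0 = D.pt 0 ∧ (E t).pt 1 = D.pt 1) →
        (∀ s t : ℝ, 0 < s → s < t → closure (E s).carrier ∩ closure (D.carrier \ (E t).carrier) = ∅) →
        (∀ γ : CurveClass ℂ, (∀ t : ℝ, 0 < t → γ.range ⊆ closure (E t).carrier) →
          γ.range ⊆ closure D'.carrier) →
        P D (CurveClass.rangeSubset (closure D'.carrier)) ≠ 0 →
          ∀ f : CurveClass ℂ →ᵇ ℝ, Tendsto (fun t : ℝ => ∫ γ, f γ ∂(P (E t))) (𝓝[>] (0 : ℝ))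
            (𝓝 (∫ γ, f γ ∂(P D')))

/-- **F′ (geometry of composition 3), named** (OPEN, plane topology + Radó). Every pair `D' ⊆ D` with the same marked
points admits a separated exhausting outer squeeze `E t` inside `D` TOGETHER WITH closed-disc uniformizers
`Φ t : ℂ → ℂ` of `E t` (continuous on `ℂ`, conformal from the open unit disc onto `E t`, `Φ t (∓1)` = the marked
points) converging UNIFORMLY ON THE CLOSED DISC, as `t → 0⁺`, to such a uniformizer `Φ` of `D'` — the hypothesis
shape of the existing crux `DiscContinuity` (stmt-CriticalPhenomena-6755). -/
def RadoSqueezeFamily : Prop :=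
  ∀ (D D' : DobrushinDomain), D'.carrier ⊆ D.carrier → D'.pt 0 = D.pt 0 → D'.pt 1 = D.pt 1 →
    ∃ E : ℝ → DobrushinDomain,
      (∀ t : ℝ, 0 < t → D'.carrier ⊆ (E t).carrier ∧ (E t).carrier ⊆ D.carrier ∧
        (E t).pt 0 = D.pt 0 ∧ (E t).pt 1 = D.pt 1) ∧
      (∀ s t : ℝ, 0 < s → s < t → closure (E s).carrier ∩ closure (D.carrier \ (E t).carrier) = ∅) ∧
      (∀ γ : CurveClass ℂ, (∀ t : ℝ, 0 < t → γ.range ⊆ closure (E t).carrier) →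
        γ.range ⊆ closure D'.carrier) ∧
      ∃ (Φt : ℝ → C(ℂ, ℂ)) (Φ : C(ℂ, ℂ)),
        (∀ t : ℝ, 0 < t → ∃ g : ConformalEquiv (Metric.ball (0 : ℂ) 1) (E t).carrier,
          Set.EqOn (Φt t) g (Metric.ball (0 : ℂ) 1)) ∧
        (∃ g : ConformalEquiv (Metric.ball (0 : ℂ) 1) D'.carrier, Set.EqOn Φ g (Metric.ball (0 : ℂ) 1)) ∧
        (∀ t : ℝ, 0 < t → (E t).pt 0 = Φt t (-1) ∧ (E t).pt 1 = Φt t 1) ∧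
        D'.pt 0 = Φ (-1) ∧ D'.pt 1 = Φ 1 ∧
        TendstoUniformlyOn (fun t => ((Φt t : C(ℂ, ℂ)) : ℂ → ℂ)) (Φ : ℂ → ℂ) (𝓝[>] (0 : ℝ))
          (Metric.closedBall (0 : ℂ) 1)

/-- **CC4 (bridge of composition 4), named** (provable now; landed by lead c2). The existing crux `ConfCovLimit`
(stmt-CriticalPhenomena-0771: a conformally covariant scaling limit EXISTS) implies the crux, both in their
SAWConfRestriction copies. -/
def RestrictionOfLimitOfConfCovLimit : Prop :=
  Summit.CriticalPhenomena.SAWScalingLimit.Theses.SAWConfRestriction.ConfCovLimit →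
    Summit.CriticalPhenomena.SAWScalingLimit.Theses.SAWConfRestriction.RestrictionOfLimit

/-- **CoL5 (bridge of composition 5), named** (provable now; landed by lead c2). The existing crux `ContinuityOfLimit`
(stmt-CriticalPhenomena-7305: the scaling limit is Radó-continuous in the domain) implies the crux, both in their
SAWConePseudogroup copies. -/
def RestrictionOfLimitOfContinuityOfLimit : Prop :=
  Summit.CriticalPhenomena.SAWScalingLimit.Theses.SAWConePseudogroup.ContinuityOfLimit →
    Summit.CriticalPhenomena.SAWScalingLimit.Theses.SAWConePseudogroup.RestrictionOfLimit

/-! ### Proved glue of composition 1 -/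

/-- A curve staying in `S` either touches `F` or avoids it: `R ⊆ (R ∩ Touch_F) ∪ rangeSubset Fᶜ`. -/
theorem rangeSubset_subset_touch_union (S F : Set ℂ) :
    (CurveClass.rangeSubset S : Set (CurveClass ℂ)) ⊆
      (CurveClass.rangeSubset S ∩ {γ : CurveClass ℂ | (γ.range ∩ F).Nonempty}) ∪
        CurveClass.rangeSubset Fᶜ := by
  intro γ hγ
  by_cases h : (γ.range ∩ F).Nonempty
  · exact Or.inl ⟨hγ, h⟩
  · exact Or.inr (CurveClass.mem_rangeSubset.2 fun z hz hzF => h ⟨z, hz, hzF⟩)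

/-- **The reshape of S3 is sufficient**: S3b ∧ S3a ∧ S3c∃ → S3∃. Hull case: ANY endpoint approximation of `D'`
works (`SAW.exists_isEndpointApprox`), since `P D (R) ≤ P D (R ∩ Touch_F) + P D (rangeSubset Fᶜ) = 0 + … ≤ liminf p_δ`;
non-hull case: S3c∃ verbatim. -/
theorem existsNoAvoidanceLoss_of_split (hI : InteriorAvoidance) (hT : NullTouchHull)
    (hNH : NoAvoidanceLossNonHullExists) : ExistsNoAvoidanceLoss := by
  intro P hP D D' hsub h0 h1
  by_cases hH : D.IsHullSubdomain D'
  · obtain ⟨a, b, hab⟩ := SAW.exists_isEndpointApprox D'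
    refine ⟨a, b, hab, ?_⟩
    calc P D (CurveClass.rangeSubset (closure D'.carrier))
        ≤ P D ((CurveClass.rangeSubset (closure D'.carrier) ∩
              {γ : CurveClass ℂ | (γ.range ∩ closure (D.carrier \ D'.carrier)).Nonempty}) ∪
            CurveClass.rangeSubset (closure (D.carrier \ D'.carrier))ᶜ) :=
          measure_mono (rangeSubset_subset_touch_union _ _)
      _ ≤ P D (CurveClass.rangeSubset (closure D'.carrier) ∩
              {γ : CurveClass ℂ | (γ.range ∩ closure (D.carrier \ D'.carrier)).Nonempty}) +
            P D (CurveClass.rangeSubset (closure (D.carrier \ D'.carrier))ᶜ) := measure_union_le _ _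
      _ = P D (CurveClass.rangeSubset (closure (D.carrier \ D'.carrier))ᶜ) := by
          rw [hT P hP D D' hH, zero_add]
      _ ≤ _ := hI P hP D D' hsub h0 h1 a b hab
  · exact hNH P hP D D' hsub h0 h1 hH

/-! ### The stubs (the ONLY `sorry`s of this file)

Each stub is stated over TREE VOCABULARY ONLY, so that it lands verbatim as a
`Theorems/SAWTensorRGRestrictionOfLimit<Stub>.lean` file `--supports stmt-CriticalPhenomena-0773` without importing
this workfile; the `*_holds` theorems below certify definitionally that the unfolded text IS the named statement.
Provers landing a stub need `open MeasureTheory Filter Topology Set Literature.Probability.RandomPlanarGeometry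
Literature.Probability.LatticeModels` and `open scoped ENNReal BoundedContinuousFunction`. -/

/-- **S1 — the exact lattice restriction identity at fixed mesh.** LANDED (p147518). -/
theorem stub_latticeRestriction :
    ∀ (Ω Ω' : Set ℂ) (δ : ℝ) (a b : Site 2),
      discreteDomainGraph Ω' δ ≤ discreteDomainGraph Ω δ →
        ∀ T : Set (CurveClass ℂ),
          SAW.law Ω' δ a b ((fun γ : SAW.DomainSAW Ω' δ a b => γ.curve) ⁻¹' T) *
              SAW.law Ω δ a b
                {γ : SAW.DomainSAW Ω δ a b | ∀ e ∈ γ.walk.edges, e ∈ (discreteDomainGraph Ω' δ).edgeSet} =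
            SAW.law Ω δ a b
              (((fun γ : SAW.DomainSAW Ω δ a b => γ.curve) ⁻¹' T) ∩
                {γ : SAW.DomainSAW Ω δ a b |
                  ∀ e ∈ γ.walk.edges, e ∈ (discreteDomainGraph Ω' δ).edgeSet}) :=
  -- LANDED (p147518): Theorems/SAWTensorRGRestrictionOfLimitStubLatticeRestriction.lean
  Summit.CriticalPhenomena.SAWScalingLimit.Theorems.RestrictionOfLimit.Birth.stub_latticeRestriction

/-- **S2 — domination, the soft half of the passage to the limit.** LANDED (p148885). -/
theorem stub_domination :
    (∀ (Ω Ω' : Set ℂ) (δ : ℝ) (a b : Site 2),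
      discreteDomainGraph Ω' δ ≤ discreteDomainGraph Ω δ →
        ∀ T : Set (CurveClass ℂ),
          SAW.law Ω' δ a b ((fun γ : SAW.DomainSAW Ω' δ a b => γ.curve) ⁻¹' T) *
              SAW.law Ω δ a b
                {γ : SAW.DomainSAW Ω δ a b | ∀ e ∈ γ.walk.edges, e ∈ (discreteDomainGraph Ω' δ).edgeSet} =
            SAW.law Ω δ a b
              (((fun γ : SAW.DomainSAW Ω δ a b => γ.curve) ⁻¹' T) ∩
                {γ : SAW.DomainSAW Ω δ a b |
                  ∀ e ∈ γ.walk.edges, e ∈ (discreteDomainGraph Ω' δ).edgeSet})) →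
    ∀ P : ChordalFamily, SAW.IsScalingLimitFamily P →
      ∀ (D D' : DobrushinDomain), D'.carrier ⊆ D.carrier → D'.pt 0 = D.pt 0 → D'.pt 1 = D.pt 1 →
        ∀ (a b : ℝ → Site 2), SAW.IsEndpointApprox D' a b →
          ∀ T : Set (CurveClass ℂ), MeasurableSet T →
            Filter.liminf (fun δ : ℝ => SAW.law D.carrier δ (a δ) (b δ)
                {γ : SAW.DomainSAW D.carrier δ (a δ) (b δ) |
                  ∀ e ∈ γ.walk.edges, e ∈ (discreteDomainGraph D'.carrier δ).edgeSet})
              (𝓝[>] (0 : ℝ)) * P D' T ≤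
            P D (T ∩ CurveClass.rangeSubset (closure D'.carrier)) :=
  -- LANDED (p148885): Theorems/SAWTensorRGRestrictionOfLimitStubDomination.lean
  Summit.CriticalPhenomena.SAWScalingLimit.Theorems.RestrictionOfLimit.Birth.stub_domination

/-- **S3b — interior avoidance passes.** LANDED (p150671). -/
theorem stub_interiorAvoidance :
    ∀ P : ChordalFamily, SAW.IsScalingLimitFamily P →
      ∀ (D D' : DobrushinDomain), D'.carrier ⊆ D.carrier → D'.pt 0 = D.pt 0 → D'.pt 1 = D.pt 1 →
        ∀ (a b : ℝ → Site 2), SAW.IsEndpointApprox D' a b →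
          P D (CurveClass.rangeSubset (closure (D.carrier \ D'.carrier))ᶜ) ≤
            Filter.liminf (fun δ : ℝ => SAW.law D.carrier δ (a δ) (b δ)
                {γ : SAW.DomainSAW D.carrier δ (a δ) (b δ) |
                  ∀ e ∈ γ.walk.edges, e ∈ (discreteDomainGraph D'.carrier δ).edgeSet})
              (𝓝[>] (0 : ℝ)) :=
  -- LANDED (p150671): Theorems/SAWTensorRGRestrictionOfLimitStubInteriorAvoidance.lean
  Summit.CriticalPhenomena.SAWScalingLimit.Theorems.RestrictionOfLimit.Birth.stub_interiorAvoidance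

/-- **S3a (hardest, OPEN) — null touching for hull sub-domains.** For every full scaling-limit family `P` and every
HULL sub-domain `D'` of `D` (`MarkedDomain.IsHullSubdomain`: `D' ⊆ D`, same marked points,
`a, b ∉ closure (D ∖ D')` — LSW03 arXiv:math/0209343 §2's `𝒬*`, LSW04 p. 5 "`∂D`, `∂D'` agree near `z, w`"):
`P D ({γ ⊆ cl D'} ∩ {range γ ∩ closure (D ∖ D') ≠ ∅}) = 0` — on the event that it stays in `cl D'`, the limit
curve a.s. does not touch the removed part (no touching-without-crossing of the interior arc `cl(∂D' ∩ D)`, no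
crawling on `∂D` at its feet). Equivalently: the law under `P D` of the penetration depth of the curve towards the
removed part, measured in any separated family of hulls through `D'`, has no atom at `D'` (it has at most countably
many atoms: `countable_setOf_touch_pos`, landed). True for the SLE_{8/3} family (kernel continuity of `A ↦ Φ'_A(0)`,
cf. `HullRestrictionNull.lean`); for an abstract limit it is an anti-concentration (a-priori regularity) statement
about critical SAW that is not in print — no RSW/FKG-type conditional-crossing tool exists for SAW. -/
theorem stub_nullTouchHull :
    ∀ P : ChordalFamily, SAW.IsScalingLimitFamily P →
      ∀ (D D' : DobrushinDomain), D.IsHullSubdomain D' →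
        P D (CurveClass.rangeSubset (closure D'.carrier) ∩
          {γ : CurveClass ℂ | (γ.range ∩ closure (D.carrier \ D'.carrier)).Nonempty}) = 0 := by
  sorry

/-- **S3c∃ (OPEN) — no loss of avoidance mass for NON-hull pairs, for SOME endpoint approximation** (the
`∀`-approximation form registered by cycle 1 was mis-cut, see the module docstring). Content only when
`P D {γ ⊆ cl D'} > 0` although `D ∖ D'` reaches a marked point (dents accumulating at `a` or `b`, thin enough to be
avoided with positive probability); it then asks for an approximation `(a_δ, b_δ)` approaching the marked points
slowly enough / away from the sub-lattice part of `D ∖ D'` so that the lattice walk loses no avoidance mass — a tip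
estimate ("the SAW from `a_δ` does not backtrack towards `∂D` near its start") uniformly in `δ`, not in print. It
disappears if the planners narrow the crux to hull sub-domains (refuter rreview1, `LSWHull.lean`). -/
theorem stub_noAvoidanceLossNonHullExists :
    ∀ P : ChordalFamily, SAW.IsScalingLimitFamily P →
      ∀ (D D' : DobrushinDomain), D'.carrier ⊆ D.carrier → D'.pt 0 = D.pt 0 → D'.pt 1 = D.pt 1 →
        ¬ D.IsHullSubdomain D' →
          ∃ a b : ℝ → Site 2, SAW.IsEndpointApprox D' a b ∧
            P D (CurveClass.rangeSubset (closure D'.carrier)) ≤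
              Filter.liminf (fun δ : ℝ => SAW.law D.carrier δ (a δ) (b δ)
                  {γ : SAW.DomainSAW D.carrier δ (a δ) (b δ) |
                    ∀ e ∈ γ.walk.edges, e ∈ (discreteDomainGraph D'.carrier δ).edgeSet})
                (𝓝[>] (0 : ℝ)) := by
  sorry

/-- **G (provable now) — restriction from an outer squeeze.** For a full scaling-limit family `P`, Dobrushin `D`, `D'`
and a family `E : ℝ → DobrushinDomain` with, for `t > 0`, `D' ⊆ E t ⊆ D` and the marked points of `D`; SEPARATED
(`cl (E s) ∩ cl (D ∖ E t) = ∅` for `0 < s < t`, which forces `E s ⊆ E t`); EXHAUSTING (`γ ⊆ cl (E t)` for all `t > 0`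
implies `γ ⊆ cl D'`); and OUTER-CONTINUOUS (`∫ f dP(E t) → ∫ f dP(D')` as `t → 0⁺` for bounded continuous `f`): the
restriction identity holds for `(D, D')`. Proof plan: if `P D (R) = 0` both sides vanish; else generic restriction
(`stub_restrictionOffCountable`, landed, on the index type `{t // 0 < t}`) gives a countable exceptional set `S`;
choose `t_n ↓ 0`, `t_n ∉ S` (an interval is uncountable / has positive Lebesgue measure); then
`P (E t_n) (T) = P D (T ∩ R_n) / P D (R_n)` with `R_n = {γ ⊆ cl (E t_n)} ↓ R` (exhaustion + monotonicity), so
`P (E t_n) (T) → P D (T ∩ R) / P D (R)` for every Borel `T` (continuity from above); along `t_n` the laws also converge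
weakly to `P D'`, so portmanteau (`limsup` on closed sets `≤`, `liminf` on open sets `≥`, the landed filter versions)
gives `P D' (F) = P D (F ∩ R) / P D (R)` for all closed `F`, hence for all Borel sets (`ext_of_generate_finite`,
`borel_eq_generateFrom_isClosed`). -/
theorem stub_restrictionOfSqueeze :
    ∀ P : ChordalFamily, SAW.IsScalingLimitFamily P →
      ∀ (D D' : DobrushinDomain) (E : ℝ → DobrushinDomain),
        (∀ t : ℝ, 0 < t → D'.carrier ⊆ (E t).carrier ∧ (E t).carrier ⊆ D.carrier ∧
          (E t).pt 0 = D.pt 0 ∧ (E t).pt 1 = D.pt 1) →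
        (∀ s t : ℝ, 0 < s → s < t → closure (E s).carrier ∩ closure (D.carrier \ (E t).carrier) = ∅) →
        (∀ γ : CurveClass ℂ, (∀ t : ℝ, 0 < t → γ.range ⊆ closure (E t).carrier) →
          γ.range ⊆ closure D'.carrier) →
        (∀ f : CurveClass ℂ →ᵇ ℝ, Tendsto (fun t : ℝ => ∫ γ, f γ ∂(P (E t))) (𝓝[>] (0 : ℝ))
          (𝓝 (∫ γ, f γ ∂(P D')))) →
        ∀ T : Set (CurveClass ℂ), MeasurableSet T →
          P D' T * P D (CurveClass.rangeSubset (closure D'.carrier)) =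
            P D (T ∩ CurveClass.rangeSubset (closure D'.carrier)) :=
  -- LANDED (p154640): Theorems/SAWTensorRGRestrictionOfLimitStubRestrictionOfSqueeze.lean
  Summit.CriticalPhenomena.SAWScalingLimit.Theorems.RestrictionOfLimit.Birth.stub_restrictionOfSqueeze

/-- **F (OPEN, plane topology) — outer squeezes exist.** For Dobrushin `D' ⊆ D` with the same marked points there is a
family `E : ℝ → DobrushinDomain` with, for `t > 0`, `D' ⊆ E t ⊆ D` and the marked points of `D`, separated
(`cl (E s) ∩ cl (D ∖ E t) = ∅` for `0 < s < t`) and exhausting (`γ ⊆ cl (E t)` for all `t > 0` ⇒ `γ ⊆ cl D'`).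
Intended construction: `E t` = `D` minus the part of the closed defect `closure (D ∖ D')` at "collar depth" `≥ t`
from `cl D' ∪ ∂D`, the collar taken in a tubular/conformal coordinate of the free boundary arcs of `D'` so that each
`E t` is again a Jordan domain through `a` and `b` (Schoenflies collar, or pull back by a chordal uniformizing map and
erode the hull as in `HullRestrictionNull.erosion` / `HullExhaustion.anchoredHull`, then `ArcHullDomains`); needs the
tree's Jordan-curve / Carathéodory named facts. No probability. -/
theorem stub_squeezeFamily :
    ∀ (D D' : DobrushinDomain), D'.carrier ⊆ D.carrier → D'.pt 0 = D.pt 0 → D'.pt 1 = D.pt 1 →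
      ∃ E : ℝ → DobrushinDomain,
        (∀ t : ℝ, 0 < t → D'.carrier ⊆ (E t).carrier ∧ (E t).carrier ⊆ D.carrier ∧
          (E t).pt 0 = D.pt 0 ∧ (E t).pt 1 = D.pt 1) ∧
        (∀ s t : ℝ, 0 < s → s < t → closure (E s).carrier ∩ closure (D.carrier \ (E t).carrier) = ∅) ∧
        (∀ γ : CurveClass ℂ, (∀ t : ℝ, 0 < t → γ.range ⊆ closure (E t).carrier) →
          γ.range ⊆ closure D'.carrier) :=
  -- LANDED (p159317, worker wave 2): Theorems/SAWTensorRGRestrictionOfLimitStubSqueezeFamily.lean (+ 5 helper files)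
  Summit.CriticalPhenomena.SAWScalingLimit.Theorems.RestrictionOfLimit.Birth.stub_squeezeFamily

/-- **C (OPEN — the crux's analytic content for ALL pairs) — outer squeeze continuity of a full SAW scaling limit.**
Along every separated exhausting outer squeeze `E t ↓ D'` inside `D` (same marked points), `P (E t) ⇒ P D'` weakly as
`t → 0⁺`, provided `P D {γ ⊆ cl D'} ≠ 0`. It is implied by the restriction property of `P` for all pairs (then
`P (E t) = P D (· | γ ⊆ cl E t) → P D (· | γ ⊆ cl D') = P D'` by continuity from above), so it is not stronger than
the crux; conversely with F and G it gives the crux. For the hull pairs it is the no-atom statement S3a in disguise;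
for non-hull pairs it also contains triviality of the germ of the walk at the marked points. Directly comparable with
the route's `ContinuityOfLimit` (stmt-CriticalPhenomena-7305: continuity along uniformly convergent conformal images,
via Radó/Carathéodory for the squeezes), i.e. uniform-in-`δ` stability of the critical SAW law under boundary
perturbation — not in print before conformal invariance (Kennedy–Lawler lattice effects live exactly here). -/
theorem stub_squeezeContinuity :
    ∀ P : ChordalFamily, SAW.IsScalingLimitFamily P →
      ∀ (D D' : DobrushinDomain), D'.carrier ⊆ D.carrier → D'.pt 0 = D.pt 0 → D'.pt 1 = D.pt 1 →
        ∀ E : ℝ → DobrushinDomain,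
          (∀ t : ℝ, 0 < t → D'.carrier ⊆ (E t).carrier ∧ (E t).carrier ⊆ D.carrier ∧
            (E t).pt 0 = D.pt 0 ∧ (E t).pt 1 = D.pt 1) →
          (∀ s t : ℝ, 0 < s → s < t → closure (E s).carrier ∩ closure (D.carrier \ (E t).carrier) = ∅) →
          (∀ γ : CurveClass ℂ, (∀ t : ℝ, 0 < t → γ.range ⊆ closure (E t).carrier) →
            γ.range ⊆ closure D'.carrier) →
          P D (CurveClass.rangeSubset (closure D'.carrier)) ≠ 0 →
            ∀ f : CurveClass ℂ →ᵇ ℝ, Tendsto (fun t : ℝ => ∫ γ, f γ ∂(P (E t))) (𝓝[>] (0 : ℝ))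
              (𝓝 (∫ γ, f γ ∂(P D'))) := by
  sorry

/-- **F′ (OPEN, plane topology + Radó) — Radó squeezes exist.** For Dobrushin `D' ⊆ D` with the same marked points
there is a separated exhausting outer squeeze `E t` of `D'` inside `D` (as in `stub_squeezeFamily`) together with
closed-disc uniformizers: continuous `Φ t, Φ : ℂ → ℂ` agreeing on the open unit disc with conformal equivalences onto
`E t`, `D'`, with `Φ t (∓1)`, `Φ (∓1)` the marked points, and `Φ t → Φ` UNIFORMLY ON THE CLOSED DISC as `t → 0⁺`.
Intended construction: in each component `C` of the defect `D ∖ cl D'` (a simply connected Jordan piece bounded by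
arcs of `∂D' ∩ D` and of `∂D`) take the harmonic/strip coordinate `u` (`u = 0` on `∂D'`, `u = 1` on `∂D`) and remove
from `D` the truncated super-level sets `{u ≥ t, |v| ≤ 1/t}` of finitely many components (more as `t ↓ 0`): each
`E t` is `D` with finitely many three-sided bites, a Jordan domain through `a, b`; the bites are compact in the open
components away from `cl D'` (separation), fill the defect as `t ↓ 0` (exhaustion), and the boundary loops converge
uniformly to `∂D'`, so Radó's theorem (`JordanDomain.rado_tendstoUniformlyOn_holds`, discharged in the tree) with a
three-point / marked-point normalisation (`ChordalUniformizerConvergence`) gives the uniformizers. Needs Riemann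
maps of the components, Carathéodory extension (`JordanDomain.exists_continuousOn_extension`) and Jordan-curve
bookkeeping; no probability. With the landed glue G and the existing crux `DiscContinuity` (stmt-6755) it closes the
crux (composition 3). -/
theorem stub_radoSqueezeFamily :
    ∀ (D D' : DobrushinDomain), D'.carrier ⊆ D.carrier → D'.pt 0 = D.pt 0 → D'.pt 1 = D.pt 1 →
      ∃ E : ℝ → DobrushinDomain,
        (∀ t : ℝ, 0 < t → D'.carrier ⊆ (E t).carrier ∧ (E t).carrier ⊆ D.carrier ∧
          (E t).pt 0 = D.pt 0 ∧ (E t).pt 1 = D.pt 1) ∧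
        (∀ s t : ℝ, 0 < s → s < t → closure (E s).carrier ∩ closure (D.carrier \ (E t).carrier) = ∅) ∧
        (∀ γ : CurveClass ℂ, (∀ t : ℝ, 0 < t → γ.range ⊆ closure (E t).carrier) →
          γ.range ⊆ closure D'.carrier) ∧
        ∃ (Φt : ℝ → C(ℂ, ℂ)) (Φ : C(ℂ, ℂ)),
          (∀ t : ℝ, 0 < t → ∃ g : ConformalEquiv (Metric.ball (0 : ℂ) 1) (E t).carrier,
            Set.EqOn (Φt t) g (Metric.ball (0 : ℂ) 1)) ∧
          (∃ g : ConformalEquiv (Metric.ball (0 : ℂ) 1) D'.carrier, Set.EqOn Φ g (Metric.ball (0 : ℂ) 1)) ∧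
          (∀ t : ℝ, 0 < t → (E t).pt 0 = Φt t (-1) ∧ (E t).pt 1 = Φt t 1) ∧
          D'.pt 0 = Φ (-1) ∧ D'.pt 1 = Φ 1 ∧
          TendstoUniformlyOn (fun t => ((Φt t : C(ℂ, ℂ)) : ℂ → ℂ)) (Φ : ℂ → ℂ) (𝓝[>] (0 : ℝ))
            (Metric.closedBall (0 : ℂ) 1) :=
  -- LANDED (p167791, worker wave 3): Theorems/SAWTensorRGRestrictionOfLimitStubRadoSqueezeFamily.lean (+ 14 helper files)
  Summit.CriticalPhenomena.SAWScalingLimit.Theorems.RestrictionOfLimit.Birth.stub_radoSqueezeFamily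

/-- **DC — the EXISTING crux `DiscContinuity` (stmt-CriticalPhenomena-6755, route SAWExpCovariance), BY NAME.**
Domain continuity of the SAW limit in the Radó/Fréchet sense: if closed-disc uniformizers `Φ_n → Φ` uniformly on the
closed unit disc (conformal from the open disc onto Dobrushin domains `D_n`, `D`, marked points `Φ_n(∓1)`, `Φ(∓1)`),
then `P D_n ⇒ P D` weakly, for every scaling-limit family `P`. Registered here as a stub whose statement IS the
foreign obligation (the skeleton audit admits hypotheses only under registered stub names), so that composition 3
records: `RestrictionOfLimit` ⟸ `DiscContinuity` + plane geometry (F′) + the landed glue (G). Discharged the day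
stmt-6755 is proved (`exact` its `_holds` theorem). -/
theorem stub_discContinuity :
    Summit.CriticalPhenomena.SAWScalingLimit.Theses.SAWExpCovariance.DiscContinuity := by
  sorry

/-- **CC4 (provable now — bridge of composition 4) — `ConfCovLimit → RestrictionOfLimit`.** If a conformally covariant
scaling limit `P₀` of the critical SAW exists (stmt-CriticalPhenomena-0771), then every scaling-limit family `P` equals
`P₀` (`SAW.IsScalingLimitFamily.unique`), hence is conformally covariant, hence weakly continuous along every Radó
squeeze (`IsConformallyCovariant.tendsto_integral_of_discUniformizers`: `P (E t) = (Φ t)_* P B` over a unit-disc parameter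
domain `B`, dominated convergence on the compact traces), and the landed glue G + geometry F′ give the identity for every
pair. Proved in `work/stubs/OfConfCov.lean` (lands as `Theorems/SAWTensorRGRestrictionOfLimitOfConfCov.lean`); kept a
LANDED (p172190). -/
theorem stub_restrictionOfLimitOfConfCovLimit :
    Summit.CriticalPhenomena.SAWScalingLimit.Theses.SAWConfRestriction.ConfCovLimit →
      Summit.CriticalPhenomena.SAWScalingLimit.Theses.SAWConfRestriction.RestrictionOfLimit :=
  -- LANDED (p172190, lead c2): Theorems/SAWTensorRGRestrictionOfLimitOfConfCov.lean
  Summit.CriticalPhenomena.SAWScalingLimit.Theorems.RestrictionOfLimit.Birth.stub_restrictionOfLimitOfConfCovLimit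

/-- **CC — the EXISTING crux `ConfCovLimit` (stmt-CriticalPhenomena-0771, routes SAWConfRestriction r2 /
SAWBrownianDomination r4 / SAWTowerCount; = the conclusion of SAWTensorRG's `LimitGlue`; = `LimitExists` + the output
of SAWConePseudogroup's `CovarianceUpgrade`), BY NAME.** Existence AND conformal covariance of the SAW scaling limit —
THE open problem (LSW04 p. 3; Duminil-Copin–Smirnov 2012 Conj. 1). Registered as a stub whose statement IS the foreign
obligation, so that composition 4 records `RestrictionOfLimit ⟸ ConfCovLimit` + plane geometry (F′) + glue (G), all
landed. Every one of the five consuming routes carries this obligation (or a stronger one) as its own item. -/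
theorem stub_confCovLimit :
    Summit.CriticalPhenomena.SAWScalingLimit.Theses.SAWConfRestriction.ConfCovLimit := by
  sorry

/-- **CoL5 (provable now — bridge of composition 5) — `ContinuityOfLimit → RestrictionOfLimit`.** If the scaling limit
is Radó-continuous (stmt-CriticalPhenomena-7305: `Φ_n → Φ` uniformly on `closure B`, conformal on `B`, injective on
`closure B` ⇒ `P (Φ_n B) ⇒ P (Φ B)`), then it is weakly continuous along every Radó squeeze: the closed-disc
uniformizers of F′ agree on the open disc with conformal equivalences onto JORDAN domains, so by Carathéodory
(`JordanDomain.exists_continuousOn_extension_holds`, PROVED in the tree) they are injective on the CLOSED disc; the filter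
`𝓝[>] 0` is sequentialised (`Filter.tendsto_iff_seq_tendsto`). Then G + F′. Proved in `work/stubs/OfContinuityOfLimit.lean`
LANDED (p172244). -/
theorem stub_restrictionOfLimitOfContinuityOfLimit :
    Summit.CriticalPhenomena.SAWScalingLimit.Theses.SAWConePseudogroup.ContinuityOfLimit →
      Summit.CriticalPhenomena.SAWScalingLimit.Theses.SAWConePseudogroup.RestrictionOfLimit :=
  -- LANDED (p172244, lead c2): Theorems/SAWTensorRGRestrictionOfLimitOfContinuityOfLimit.lean
  Summit.CriticalPhenomena.SAWScalingLimit.Theorems.RestrictionOfLimit.Birth.stub_restrictionOfLimitOfContinuityOfLimit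

/-- **CoL — the EXISTING crux `ContinuityOfLimit` (stmt-CriticalPhenomena-7305, route SAWConePseudogroup r4), BY NAME.**
Radó continuity of the SAW scaling limit in the domain (`∀ P, IsChordal P → (lim) P → P.IsRadoContinuous`): uniform-in-`δ`
stability of the critical SAW law under boundary perturbation, BEFORE conformal invariance (Kennedy–Lawler lattice effects
live here; not in print). Registered as a stub whose statement IS the foreign obligation, so that composition 5 records
`RestrictionOfLimit ⟸ ContinuityOfLimit` + plane geometry (F′, Carathéodory) + glue (G), all landed. In the tree:
`ConfCovLimit → ContinuityOfLimit → DiscContinuity` (p172244), so the three foreign obligations of compositions 3/4/5 are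
ordered 0771 ⇒ 7305 ⇒ 6755 and `stub_discContinuity` is the weakest. -/
theorem stub_continuityOfLimit :
    Summit.CriticalPhenomena.SAWScalingLimit.Theses.SAWConePseudogroup.ContinuityOfLimit := by
  sorry

/-! ### Proved glue of composition 4: covariance ⇒ weak continuity along a Radó squeeze ⇒ restriction -/

/-- **A conformally covariant SAW scaling limit has the restriction property for every pair** (the core of
composition 4; identical to `Theorems/…OfConfCov.lean: isRestriction_of_isConformallyCovariant`). -/
theorem isRestriction_of_isConformallyCovariant {P : ChordalFamily} (hP : SAW.IsScalingLimitFamily P)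
    (hcov : P.IsConformallyCovariant) : P.IsRestriction :=
  -- LANDED (p172190): G + F′ + `IsConformallyCovariant.tendsto_integral_of_discUniformizers`
  Summit.CriticalPhenomena.SAWScalingLimit.Theorems.RestrictionOfLimit.Birth.isRestriction_of_isConformallyCovariant hP hcov

/-! ### Proved glue of composition 5: Radó continuity ⇒ weak continuity along a Radó squeeze ⇒ restriction -/

/-- **A Radó-continuous SAW scaling limit has the restriction property for every pair** (the core of composition 5,
LANDED p172244: Carathéodory injectivity of the closed-disc uniformizers of F′ on the closed disc, sequentialisation of
`𝓝[>] 0`, then G). -/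
theorem isRestriction_of_isRadoContinuous {P : ChordalFamily} (hP : SAW.IsScalingLimitFamily P)
    (hR : P.IsRadoContinuous) : P.IsRestriction :=
  Summit.CriticalPhenomena.SAWScalingLimit.Theorems.RestrictionOfLimit.Birth.isRestriction_of_isRadoContinuous hP hR

/-- **The foreign obligations are ordered**: `ConfCovLimit → ContinuityOfLimit` (LANDED p172244). -/
theorem continuityOfLimit_of_confCovLimit
    (hCC : Summit.CriticalPhenomena.SAWScalingLimit.Theses.SAWConfRestriction.ConfCovLimit) :
    Summit.CriticalPhenomena.SAWScalingLimit.Theses.SAWConePseudogroup.ContinuityOfLimit :=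
  Summit.CriticalPhenomena.SAWScalingLimit.Theorems.RestrictionOfLimit.Birth.continuityOfLimit_of_confCovLimit hCC

/-- **The foreign obligations are ordered**: `ContinuityOfLimit → DiscContinuity` (LANDED p172244). -/
theorem discContinuity_of_continuityOfLimit
    (hCoL : Summit.CriticalPhenomena.SAWScalingLimit.Theses.SAWConePseudogroup.ContinuityOfLimit) :
    Summit.CriticalPhenomena.SAWScalingLimit.Theses.SAWExpCovariance.DiscContinuity :=
  Summit.CriticalPhenomena.SAWScalingLimit.Theorems.RestrictionOfLimit.Birth.discContinuity_of_continuityOfLimit hCoL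

/-! ### Proved glue of composition 3: `DiscContinuity` (stmt-CriticalPhenomena-6755) along a Radó squeeze -/

/-- **Outer continuity from `DiscContinuity`.** If the existing crux `DiscContinuity` (stmt-CriticalPhenomena-6755,
route SAWExpCovariance: `P D_n ⇒ P D` whenever closed-disc uniformizers converge uniformly on the closed disc) holds,
then along a Radó squeeze (`stub_radoSqueezeFamily`) the laws `P (E t)` converge weakly to `P D'` as `t → 0⁺`:
sequential characterisation of the limit along `𝓝[>] 0` (`Filter.tendsto_iff_seq_tendsto`), the sequence made
positive on its finitely many non-positive terms, and `DiscContinuity` applied to `D_n = E (t_n)`, `Φ_n = Φ (t_n)`. -/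
theorem tendsto_integral_of_discContinuity
    (hDC : Summit.CriticalPhenomena.SAWScalingLimit.Theses.SAWExpCovariance.DiscContinuity)
    {P : ChordalFamily} (hP : SAW.IsScalingLimitFamily P) {D' : DobrushinDomain} {E : ℝ → DobrushinDomain}
    {Φt : ℝ → C(ℂ, ℂ)} {Φ : C(ℂ, ℂ)}
    (hΦt : ∀ t : ℝ, 0 < t → ∃ g : ConformalEquiv (Metric.ball (0 : ℂ) 1) (E t).carrier,
      Set.EqOn (Φt t) g (Metric.ball (0 : ℂ) 1))
    (hΦ : ∃ g : ConformalEquiv (Metric.ball (0 : ℂ) 1) D'.carrier, Set.EqOn Φ g (Metric.ball (0 : ℂ) 1))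
    (hmk : ∀ t : ℝ, 0 < t → (E t).pt 0 = Φt t (-1) ∧ (E t).pt 1 = Φt t 1)
    (h0 : D'.pt 0 = Φ (-1)) (h1 : D'.pt 1 = Φ 1)
    (hunif : TendstoUniformlyOn (fun t => ((Φt t : C(ℂ, ℂ)) : ℂ → ℂ)) (Φ : ℂ → ℂ) (𝓝[>] (0 : ℝ))
      (Metric.closedBall (0 : ℂ) 1))
    (f : CurveClass ℂ →ᵇ ℝ) :
    Tendsto (fun t : ℝ => ∫ γ, f γ ∂(P (E t))) (𝓝[>] (0 : ℝ)) (𝓝 (∫ γ, f γ ∂(P D'))) := by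
  rw [Filter.tendsto_iff_seq_tendsto]
  intro u hu
  -- the sequence is eventually positive; make it positive everywhere
  have hu_pos : ∀ᶠ n in atTop, 0 < u n :=
    (hu.eventually (eventually_mem_nhdsWithin (a := (0 : ℝ)) (s := Ioi 0))).mono fun n hn => hn
  set u' : ℕ → ℝ := fun n => if 0 < u n then u n else 1 with hu'_def
  have hu'_pos : ∀ n, 0 < u' n := fun n => by
    simp only [hu'_def]
    split_ifs with h
    · exact h
    · exact one_pos
  have hu'_eq : ∀ᶠ n in atTop, u' n = u n := hu_pos.mono fun n hn => by simp [hu'_def, hn]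
  have hu' : Tendsto u' atTop (𝓝[>] (0 : ℝ)) := hu.congr' (hu'_eq.mono fun n hn => hn.symm)
  -- `DiscContinuity` along `u'`
  have hunif' : TendstoUniformlyOn (fun n => ((Φt (u' n) : C(ℂ, ℂ)) : ℂ → ℂ)) (Φ : ℂ → ℂ) atTop
      (Metric.closedBall (0 : ℂ) 1) := by
    rw [Metric.tendstoUniformlyOn_iff] at hunif ⊢
    intro ε hε
    exact hu'.eventually (hunif ε hε)
  have key := hDC P hP.1 hP.2 (fun n => E (u' n)) D' (fun n => Φt (u' n)) Φ
    (fun n => hΦt (u' n) (hu'_pos n)) hΦ (fun n => hmk (u' n) (hu'_pos n)) h0 h1 hunif' f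
  refine key.congr' (hu'_eq.mono fun n hn => ?_)
  simp only [Function.comp_apply, hn]

/-! ### Consistency: each named statement IS its registered stub (definitionally) -/

theorem latticeRestriction_holds : LatticeRestriction := stub_latticeRestriction
theorem domination_holds : Domination := stub_domination
theorem interiorAvoidance_holds : InteriorAvoidance := stub_interiorAvoidance
theorem nullTouchHull_holds : NullTouchHull := stub_nullTouchHull
theorem noAvoidanceLossNonHullExists_holds : NoAvoidanceLossNonHullExists := stub_noAvoidanceLossNonHullExists
theorem existsNoAvoidanceLoss_holds : ExistsNoAvoidanceLoss :=
  existsNoAvoidanceLoss_of_split stub_interiorAvoidance stub_nullTouchHull stub_noAvoidanceLossNonHullExists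
theorem restrictionOfSqueeze_holds : RestrictionOfSqueeze := stub_restrictionOfSqueeze
theorem squeezeFamily_holds : SqueezeFamily := stub_squeezeFamily
theorem squeezeContinuity_holds : SqueezeContinuity := stub_squeezeContinuity
theorem radoSqueezeFamily_holds : RadoSqueezeFamily := stub_radoSqueezeFamily
theorem discContinuity_holds :
    Summit.CriticalPhenomena.SAWScalingLimit.Theses.SAWExpCovariance.DiscContinuity := stub_discContinuity
theorem restrictionOfLimitOfConfCovLimit_holds : RestrictionOfLimitOfConfCovLimit :=
  stub_restrictionOfLimitOfConfCovLimit
theorem confCovLimit_holds :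
    Summit.CriticalPhenomena.SAWScalingLimit.Theses.SAWConfRestriction.ConfCovLimit := stub_confCovLimit
theorem restrictionOfLimitOfContinuityOfLimit_holds : RestrictionOfLimitOfContinuityOfLimit :=
  stub_restrictionOfLimitOfContinuityOfLimit
theorem continuityOfLimit_holds :
    Summit.CriticalPhenomena.SAWScalingLimit.Theses.SAWConePseudogroup.ContinuityOfLimit := stub_continuityOfLimit

/-! ### Name-keyed aliases of the open statements — the hypotheses of the compositions

The native skeleton audit admits a hypothesis of the skeleton theorem only if its head constant is NAMED like a
declared stub; `__Registered.stub_X` is the statement of `stub_X` under that name (each alias is `rfl`-equal to its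
statement). -/
namespace __Registered

/-- Alias of `NullTouchHull` keyed by the registered stub name. -/
abbrev stub_nullTouchHull : Prop := NullTouchHull
/-- Alias of `NoAvoidanceLossNonHullExists` keyed by the registered stub name. -/
abbrev stub_noAvoidanceLossNonHullExists : Prop := NoAvoidanceLossNonHullExists
/-- Alias of `SqueezeContinuity` keyed by the registered stub name. -/
abbrev stub_squeezeContinuity : Prop := SqueezeContinuity
/-- Alias of the foreign obligation `DiscContinuity` (stmt-6755) keyed by the registered stub name. -/
abbrev stub_discContinuity : Prop :=
  Summit.CriticalPhenomena.SAWScalingLimit.Theses.SAWExpCovariance.DiscContinuity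
/-- Alias of the foreign obligation `ConfCovLimit` (stmt-0771) keyed by the registered stub name. -/
abbrev stub_confCovLimit : Prop :=
  Summit.CriticalPhenomena.SAWScalingLimit.Theses.SAWConfRestriction.ConfCovLimit
/-- Alias of the foreign obligation `ContinuityOfLimit` (stmt-7305) keyed by the registered stub name. -/
abbrev stub_continuityOfLimit : Prop :=
  Summit.CriticalPhenomena.SAWScalingLimit.Theses.SAWConePseudogroup.ContinuityOfLimit

end __Registered

/-! ### Composition 1: S3a + S3c∃ imply the crux, BY NAME -/

/-- **`RestrictionOfLimit` from the line `birth`, composition 1** (kernel-checked, no `sorry` of its own): bundle the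
crux's hypotheses into `SAW.IsScalingLimitFamily P`; S3b (landed), S3a and S3c∃ give an endpoint approximation of `D'`
with no loss of avoidance mass (`existsNoAvoidanceLoss_of_split`); the localised squeeze
`restriction_pair_of_noAvoidanceLoss` (landed; S2 fed S1 at `univ`, `T`, `Tᶜ`, finiteness) gives the identity.
Hypotheses = the two open stubs of composition 1 under their registered names; conclusion = the route decl, by name. -/
theorem RestrictionOfLimit_of
    (hT : __Registered.stub_nullTouchHull) (hNH : __Registered.stub_noAvoidanceLossNonHullExists) :
    Summit.CriticalPhenomena.SAWScalingLimit.Theses.SAWConePseudogroup.RestrictionOfLimit := by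
  have hI : InteriorAvoidance := interiorAvoidance_holds
  have hN : ExistsNoAvoidanceLoss := existsNoAvoidanceLoss_of_split hI hT hNH
  intro P hch hlim D D' hsub h0 h1 T hTm
  have hP : SAW.IsScalingLimitFamily P := ⟨hch, hlim⟩
  obtain ⟨a, b, hab, hloss⟩ := hN P hP D D' hsub h0 h1
  exact Summit.CriticalPhenomena.SAWScalingLimit.Theorems.RestrictionOfLimit.Birth.restriction_pair_of_noAvoidanceLoss
    hP hsub h0 h1 hab hloss hTm

/-! ### Composition 2: G + F + C imply the crux, BY NAME -/

/-- **`RestrictionOfLimit` from the line `birth`, composition 2** (kernel-checked, no `sorry` of its own): if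
`P D {γ ⊆ cl D'} = 0` both sides vanish (the right side is dominated by it); otherwise F gives an outer squeeze of `D'`
inside `D`, C gives weak continuity of `P` along it, and G concludes. Hypotheses = the two open stubs of composition 2
under their registered names (G landed and discharged inside); conclusion = the route decl, by name. -/
theorem RestrictionOfLimit_of_squeeze (hC : __Registered.stub_squeezeContinuity) :
    Summit.CriticalPhenomena.SAWScalingLimit.Theses.SAWConePseudogroup.RestrictionOfLimit := by
  -- G (p154640) and F (p159317) are LANDED: discharged here, no longer hypotheses of the skeleton theorem
  have hG : RestrictionOfSqueeze := restrictionOfSqueeze_holds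
  have hF : SqueezeFamily := squeezeFamily_holds
  intro P hch hlim D D' hsub h0 h1 T hTm
  have hP : SAW.IsScalingLimitFamily P := ⟨hch, hlim⟩
  by_cases hR : P D (CurveClass.rangeSubset (closure D'.carrier)) = 0
  · rw [hR, mul_zero]
    exact (le_antisymm ((measure_mono Set.inter_subset_right).trans hR.le) bot_le).symm
  · obtain ⟨E, hN, hS, hX⟩ := hF D D' hsub h0 h1
    exact hG P hP D D' E hN hS hX (hC P hP D D' hsub h0 h1 E hN hS hX hR) T hTm

/-! ### Composition 3: G + F′ + the EXISTING crux `DiscContinuity` (stmt-CriticalPhenomena-6755) imply the crux -/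

/-- **`RestrictionOfLimit` from the line `birth`, composition 3** (kernel-checked, no `sorry` of its own): F′ gives a
Radó squeeze of `D'` inside `D`; the existing crux `DiscContinuity` (stmt-CriticalPhenomena-6755, route
SAWExpCovariance, taken as a hypothesis BY NAME) gives weak continuity of `P` along it
(`tendsto_integral_of_discContinuity`); the landed glue G concludes. Hypotheses = the glue and the geometric stub
under their registered names plus the foreign obligation `DiscContinuity`; conclusion = the route decl, by name. So,
modulo plane geometry (F′), the crux `RestrictionOfLimit` is implied by the crux `DiscContinuity`. -/
theorem RestrictionOfLimit_of_discContinuity (hDC : __Registered.stub_discContinuity) :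
    Summit.CriticalPhenomena.SAWScalingLimit.Theses.SAWConePseudogroup.RestrictionOfLimit := by
  -- G (p154640) and F′ (p167791) are LANDED: discharged here; the ONLY hypothesis left is `DiscContinuity`
  have hG : RestrictionOfSqueeze := restrictionOfSqueeze_holds
  have hF : RadoSqueezeFamily := radoSqueezeFamily_holds
  intro P hch hlim D D' hsub h0 h1 T hTm
  have hP : SAW.IsScalingLimitFamily P := ⟨hch, hlim⟩
  obtain ⟨E, hN, hS, hX, Φt, Φ, hΦt, hΦ, hmk, h0', h1', hunif⟩ := hF D D' hsub h0 h1
  exact hG P hP D D' E hN hS hX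
    (fun f => tendsto_integral_of_discContinuity hDC hP hΦt hΦ hmk h0' h1' hunif f) T hTm

/-! ### Composition 4: G + F′ + the EXISTING crux `ConfCovLimit` (stmt-CriticalPhenomena-0771) imply the crux -/

/-- **`RestrictionOfLimit` from the line `birth`, composition 4** (kernel-checked, no `sorry` of its own): if a
conformally covariant scaling limit `P₀` exists (`ConfCovLimit`, BY NAME), every `P` in the crux's binder equals `P₀`
(`SAW.IsScalingLimitFamily.unique`), so it is covariant and `isRestriction_of_isConformallyCovariant` (G + F′ + the
Literature continuity lemma, all landed) gives the identity. Hypothesis = the foreign obligation under its registered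
name; conclusion = the route decl, by name. -/
theorem RestrictionOfLimit_of_confCovLimit (hCC : __Registered.stub_confCovLimit) :
    Summit.CriticalPhenomena.SAWScalingLimit.Theses.SAWConePseudogroup.RestrictionOfLimit := by
  obtain ⟨P₀, hch₀, hlim₀, hcov₀⟩ := hCC
  intro P hch hlim D D' hsub h0 h1 T hTm
  have hP : SAW.IsScalingLimitFamily P := ⟨hch, hlim⟩
  have hP₀ : SAW.IsScalingLimitFamily P₀ := ⟨hch₀, hlim₀⟩
  rw [hP.unique hP₀]
  exact isRestriction_of_isConformallyCovariant hP₀ hcov₀ D D' hsub h0 h1 T hTm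

/-! ### Composition 5: G + F′ + Carathéodory + the EXISTING crux `ContinuityOfLimit` (stmt-CriticalPhenomena-7305) -/

/-- **`RestrictionOfLimit` from the line `birth`, composition 5** (kernel-checked, no `sorry` of its own): Radó continuity
of the scaling limit (`ContinuityOfLimit`, BY NAME) makes `P` weakly continuous along the Radó squeeze of any pair (the
closed-disc uniformizers of F′ are injective on the closed disc by Carathéodory), and G concludes
(`isRestriction_of_isRadoContinuous`, landed). Hypothesis = the foreign obligation under its registered name; conclusion
= the route decl, by name. -/
theorem RestrictionOfLimit_of_continuityOfLimit (hCoL : __Registered.stub_continuityOfLimit) :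
    Summit.CriticalPhenomena.SAWScalingLimit.Theses.SAWConePseudogroup.RestrictionOfLimit := by
  intro P hch hlim D D' hsub h0 h1 T hTm
  exact isRestriction_of_isRadoContinuous ⟨hch, hlim⟩ (hCoL P hch hlim) D D' hsub h0 h1 T hTm

/-- **Composition 3 is the weakest of 3/4/5**: the foreign obligation of composition 5 implies that of composition 3. -/
example (hCoL : __Registered.stub_continuityOfLimit) : __Registered.stub_discContinuity :=
  discContinuity_of_continuityOfLimit hCoL

/-- **Composition 5's obligation is implied by composition 4's.** -/
example (hCC : __Registered.stub_confCovLimit) : __Registered.stub_continuityOfLimit :=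
  continuityOfLimit_of_confCovLimit hCC

/-! ### The four sibling copies of the crux (syntactically identical bodies), closed by the same terms -/

/-- The SAWConfRestriction copy (r4; the item's first home), composition 1. -/
theorem RestrictionOfLimit_of_confRestriction
    (hT : __Registered.stub_nullTouchHull) (hNH : __Registered.stub_noAvoidanceLossNonHullExists) :
    Summit.CriticalPhenomena.SAWScalingLimit.Theses.SAWConfRestriction.RestrictionOfLimit :=
  RestrictionOfLimit_of hT hNH

/-- The SAWBrownianDomination copy (r5), composition 1. -/
theorem RestrictionOfLimit_of_brownianDomination
    (hT : __Registered.stub_nullTouchHull) (hNH : __Registered.stub_noAvoidanceLossNonHullExists) :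
    Summit.CriticalPhenomena.SAWScalingLimit.Theses.SAWBrownianDomination.RestrictionOfLimit :=
  RestrictionOfLimit_of hT hNH

/-- The SAWTowerCount copy (support), composition 1. -/
theorem RestrictionOfLimit_of_towerCount
    (hT : __Registered.stub_nullTouchHull) (hNH : __Registered.stub_noAvoidanceLossNonHullExists) :
    Summit.CriticalPhenomena.SAWScalingLimit.Theses.SAWTowerCount.RestrictionOfLimit :=
  RestrictionOfLimit_of hT hNH

/-- The SAWTensorRG copy (r5), composition 1. -/
theorem RestrictionOfLimit_of_tensorRG
    (hT : __Registered.stub_nullTouchHull) (hNH : __Registered.stub_noAvoidanceLossNonHullExists) :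
    Summit.CriticalPhenomena.SAWScalingLimit.Theses.SAWTensorRG.RestrictionOfLimit :=
  RestrictionOfLimit_of hT hNH

/-- The SAWConfRestriction copy, composition 2. -/
theorem RestrictionOfLimit_of_squeeze_confRestriction
    (hC : __Registered.stub_squeezeContinuity) :
    Summit.CriticalPhenomena.SAWScalingLimit.Theses.SAWConfRestriction.RestrictionOfLimit :=
  RestrictionOfLimit_of_squeeze hC

/-- The SAWBrownianDomination copy, composition 2. -/
theorem RestrictionOfLimit_of_squeeze_brownianDomination
    (hC : __Registered.stub_squeezeContinuity) :
    Summit.CriticalPhenomena.SAWScalingLimit.Theses.SAWBrownianDomination.RestrictionOfLimit :=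
  RestrictionOfLimit_of_squeeze hC

/-- The SAWTowerCount copy, composition 2. -/
theorem RestrictionOfLimit_of_squeeze_towerCount
    (hC : __Registered.stub_squeezeContinuity) :
    Summit.CriticalPhenomena.SAWScalingLimit.Theses.SAWTowerCount.RestrictionOfLimit :=
  RestrictionOfLimit_of_squeeze hC

/-- The SAWTensorRG copy, composition 2. -/
theorem RestrictionOfLimit_of_squeeze_tensorRG
    (hC : __Registered.stub_squeezeContinuity) :
    Summit.CriticalPhenomena.SAWScalingLimit.Theses.SAWTensorRG.RestrictionOfLimit :=
  RestrictionOfLimit_of_squeeze hC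

/-- The SAWConfRestriction copy, composition 3. -/
theorem RestrictionOfLimit_of_discContinuity_confRestriction
    (hDC : __Registered.stub_discContinuity) :
    Summit.CriticalPhenomena.SAWScalingLimit.Theses.SAWConfRestriction.RestrictionOfLimit :=
  RestrictionOfLimit_of_discContinuity hDC

/-- The SAWBrownianDomination copy, composition 3. -/
theorem RestrictionOfLimit_of_discContinuity_brownianDomination
    (hDC : __Registered.stub_discContinuity) :
    Summit.CriticalPhenomena.SAWScalingLimit.Theses.SAWBrownianDomination.RestrictionOfLimit :=
  RestrictionOfLimit_of_discContinuity hDC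

/-- The SAWTowerCount copy, composition 3. -/
theorem RestrictionOfLimit_of_discContinuity_towerCount
    (hDC : __Registered.stub_discContinuity) :
    Summit.CriticalPhenomena.SAWScalingLimit.Theses.SAWTowerCount.RestrictionOfLimit :=
  RestrictionOfLimit_of_discContinuity hDC

/-- The SAWTensorRG copy, composition 3. -/
theorem RestrictionOfLimit_of_discContinuity_tensorRG
    (hDC : __Registered.stub_discContinuity) :
    Summit.CriticalPhenomena.SAWScalingLimit.Theses.SAWTensorRG.RestrictionOfLimit :=
  RestrictionOfLimit_of_discContinuity hDC

/-- The SAWConfRestriction copy, composition 4. -/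
theorem RestrictionOfLimit_of_confCovLimit_confRestriction (hCC : __Registered.stub_confCovLimit) :
    Summit.CriticalPhenomena.SAWScalingLimit.Theses.SAWConfRestriction.RestrictionOfLimit :=
  RestrictionOfLimit_of_confCovLimit hCC

/-- The SAWBrownianDomination copy, composition 4. -/
theorem RestrictionOfLimit_of_confCovLimit_brownianDomination (hCC : __Registered.stub_confCovLimit) :
    Summit.CriticalPhenomena.SAWScalingLimit.Theses.SAWBrownianDomination.RestrictionOfLimit :=
  RestrictionOfLimit_of_confCovLimit hCC

/-- The SAWTowerCount copy, composition 4. -/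
theorem RestrictionOfLimit_of_confCovLimit_towerCount (hCC : __Registered.stub_confCovLimit) :
    Summit.CriticalPhenomena.SAWScalingLimit.Theses.SAWTowerCount.RestrictionOfLimit :=
  RestrictionOfLimit_of_confCovLimit hCC

/-- The SAWTensorRG copy, composition 4. -/
theorem RestrictionOfLimit_of_confCovLimit_tensorRG (hCC : __Registered.stub_confCovLimit) :
    Summit.CriticalPhenomena.SAWScalingLimit.Theses.SAWTensorRG.RestrictionOfLimit :=
  RestrictionOfLimit_of_confCovLimit hCC

/-- The SAWConfRestriction copy, composition 5. -/
theorem RestrictionOfLimit_of_continuityOfLimit_confRestriction (hCoL : __Registered.stub_continuityOfLimit) :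
    Summit.CriticalPhenomena.SAWScalingLimit.Theses.SAWConfRestriction.RestrictionOfLimit :=
  RestrictionOfLimit_of_continuityOfLimit hCoL

/-- The SAWBrownianDomination copy, composition 5. -/
theorem RestrictionOfLimit_of_continuityOfLimit_brownianDomination (hCoL : __Registered.stub_continuityOfLimit) :
    Summit.CriticalPhenomena.SAWScalingLimit.Theses.SAWBrownianDomination.RestrictionOfLimit :=
  RestrictionOfLimit_of_continuityOfLimit hCoL

/-- The SAWTowerCount copy, composition 5. -/
theorem RestrictionOfLimit_of_continuityOfLimit_towerCount (hCoL : __Registered.stub_continuityOfLimit) :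
    Summit.CriticalPhenomena.SAWScalingLimit.Theses.SAWTowerCount.RestrictionOfLimit :=
  RestrictionOfLimit_of_continuityOfLimit hCoL

/-- The SAWTensorRG copy, composition 5. -/
theorem RestrictionOfLimit_of_continuityOfLimit_tensorRG (hCoL : __Registered.stub_continuityOfLimit) :
    Summit.CriticalPhenomena.SAWScalingLimit.Theses.SAWTensorRG.RestrictionOfLimit :=
  RestrictionOfLimit_of_continuityOfLimit hCoL

/-- Wiring check, composition 5. -/
example : Summit.CriticalPhenomena.SAWScalingLimit.Theses.SAWConePseudogroup.RestrictionOfLimit :=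
  RestrictionOfLimit_of_continuityOfLimit stub_continuityOfLimit

/-- Wiring check, composition 4. -/
example : Summit.CriticalPhenomena.SAWScalingLimit.Theses.SAWConePseudogroup.RestrictionOfLimit :=
  RestrictionOfLimit_of_confCovLimit stub_confCovLimit

/-- Wiring check, composition 1 (an `example`, so that the named theorems stay the only ones concluding the crux). -/
example : Summit.CriticalPhenomena.SAWScalingLimit.Theses.SAWConePseudogroup.RestrictionOfLimit :=
  RestrictionOfLimit_of stub_nullTouchHull stub_noAvoidanceLossNonHullExists

/-- Wiring check, composition 3. -/
example : Summit.CriticalPhenomena.SAWScalingLimit.Theses.SAWConePseudogroup.RestrictionOfLimit :=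
  RestrictionOfLimit_of_discContinuity stub_discContinuity

/-- Wiring check, composition 2. -/
example : Summit.CriticalPhenomena.SAWScalingLimit.Theses.SAWConePseudogroup.RestrictionOfLimit :=
  RestrictionOfLimit_of_squeeze stub_squeezeContinuity

end Summit.CriticalPhenomena.SAWScalingLimit.Cruxes.RestrictionOfLimit.Birth

end
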